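import Mathlib

/-!
# Route BarrierLever — item `PartitionMinorsHitByVP` (stmt-ValiantsHypothesis-19717), line `hidden-states`:
# THE PENCIL OBSTRUCTION — a one-piece design whose top layer is state-starved is singular for EVERY table

Helper file (`--supports stmt-ValiantsHypothesis-19717`; cell valiant-natproofs, rung V4, 𝒟-side door (c), registered line
`Cruxes/PartitionMinorsHitByVP/Lines/hidden_states.lean` v8; prover seat val-np-p6 gen 13). Definition-free; closes NO item.

CONTEXT (memo HOME/val-np-p6/g13/MEMO-valnp6-g13.md §5–6). Beyond the diagonal the census of this seat suggests that ONE piece with the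
graded-colex threshold family serves every down-set of size `r ≥ 2^{h−1}` (Conjecture GC½, 0 BAD / 1 064), while below `2^{h−1}` it
fails exactly on star layers, and every failure is explained by a SHADOW count. This file is the kernel form of the simplest layer of that
obstruction — the PENCIL (`d = t`), which already contains the star obstruction of p560846/p562676 (`t = 1`) as a special case.

THEOREM `det_eq_zero_of_pencil`. One piece, ANY number `K` of states, ANY table `tx`. Columns `cols : Fin r → Finset (Fin K)` form a
down-closed family with members of size `≤ t + 1`, whose members of size exactly `t + 1` only use states from a set `Q`. Rows
`u : Fin r → Finset (Fin h)` (injective) contain a PENCIL `{D ∪ {b} : b ∈ B'}` (`|D| = t`, `B' ∩ D = ∅`) with `|B'| > |Q|`, and at least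
as many rows of size `≤ t` as there are columns of size `≤ t`. Then the block-additive matrix
`[∏_{a ∈ u i} (tx none a + Σ_{q ∈ cols k} tx (some q) a)]` is SINGULAR.
PROOF (formalised): pick `β ≠ 0` on `B'` with `Σ_b β_b tx(q, b) = 0` for all `q ∈ Q` (more unknowns than equations); every row of size
`≤ t` and the pencil combination `R = Σ_b β_b · row(D ∪ b)` lie, as functions of the column, in the span `W` of the indicator functions
`k ↦ [cols k' ⊆ cols k]` of the columns `k'` of size `≤ t` (`R` does because the states outside `Q` never complete a `(t+1)`-member);
`dim W ≤ #columns of size ≤ t ≤ #rows of size ≤ t`, so these `#rows + 1` vectors are dependent — a nonzero left kernel vector.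

WHAT THIS IS NOT: a no-go for ONE-PIECE designs with starved top layers only (joins with free points are untouched); the general shadow
obstruction (`d < t`, permanents) stays on paper; nothing on crux 14610 or VP ≠ VNP.
-/

set_option linter.dupNamespace false

namespace Summit.ValiantsHypothesis.ValiantsHypothesis.Theorems.BarrierLever.HiddenStates

open Finset

noncomputable section

namespace BallDiag

/-- **Expansion of a row as a combination of column indicators.** For every `S` there are coefficients `c A`, vanishing for
`|A| > |S|`, with `∏_{a ∈ S} (tx none a + Σ_{q ∈ J} tx (some q) a) = Σ_A c A · [A ⊆ J]` for every state set `J`. -/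
theorem exists_row_expansion {h K : ℕ} (tx : Option (Fin K) → Fin h → ℂ) (S : Finset (Fin h)) :
    ∃ c : Finset (Fin K) → ℂ, (∀ A, S.card < A.card → c A = 0) ∧
      ∀ J : Finset (Fin K), ∏ a ∈ S, (tx none a + ∑ q ∈ J, tx (some q) a)
        = ∑ A : Finset (Fin K), c A * (if A ⊆ J then 1 else 0) := by
  classical
  induction S using Finset.induction_on with
  | empty =>
    refine ⟨fun A => if A = ∅ then 1 else 0, ?_, ?_⟩
    · intro A hA
      show (if A = ∅ then (1 : ℂ) else 0) = 0
      rw [if_neg]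
      rintro rfl
      simp at hA
    · intro J
      rw [Finset.prod_empty]
      symm
      rw [Finset.sum_eq_single_of_mem (∅ : Finset (Fin K)) (Finset.mem_univ _)]
      · simp
      · intro A _ hA
        simp [hA]
  | insert a₀ S ha₀ ih =>
    obtain ⟨c, hc0, hc⟩ := ih
    -- new coefficients: `c' A' = c A' · tx none a₀ + Σ_{(A, q) : insert q A = A'} c A · tx (some q) a₀`
    refine ⟨fun A' => c A' * tx none a₀ +
        ∑ p ∈ (Finset.univ : Finset (Finset (Fin K) × Fin K)) with insert p.2 p.1 = A', c p.1 * tx (some p.2) a₀, ?_, ?_⟩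
    · intro A' hA'
      rw [Finset.card_insert_of_notMem ha₀] at hA'
      show c A' * tx none a₀ +
        ∑ p ∈ (Finset.univ : Finset (Finset (Fin K) × Fin K)) with insert p.2 p.1 = A', c p.1 * tx (some p.2) a₀ = 0
      rw [hc0 A' (by omega), zero_mul, zero_add]
      refine Finset.sum_eq_zero fun p hp => ?_
      obtain ⟨-, hpA⟩ := Finset.mem_filter.mp hp
      have hcard : S.card < p.1.card := by
        have h1 : A'.card ≤ p.1.card + 1 := by rw [← hpA]; exact Finset.card_insert_le p.2 p.1
        omega
      rw [hc0 p.1 hcard, zero_mul]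
    · intro J
      rw [Finset.prod_insert ha₀, hc J, Finset.mul_sum]
      -- distribute the factor of `a₀`
      have hstep : ∀ A : Finset (Fin K), (tx none a₀ + ∑ q ∈ J, tx (some q) a₀) * (c A * if A ⊆ J then 1 else 0)
          = c A * tx none a₀ * (if A ⊆ J then 1 else 0)
            + ∑ q : Fin K, c A * tx (some q) a₀ * (if insert q A ⊆ J then 1 else 0) := by
        intro A
        have hq : ∀ q : Fin K, c A * tx (some q) a₀ * (if insert q A ⊆ J then (1 : ℂ) else 0)
            = (if q ∈ J then c A * tx (some q) a₀ else 0) * (if A ⊆ J then 1 else 0) := by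
          intro q
          by_cases hqJ : q ∈ J
          · rw [if_pos hqJ]
            have : insert q A ⊆ J ↔ A ⊆ J := by
              rw [Finset.insert_subset_iff]; exact ⟨fun h' => h'.2, fun h' => ⟨hqJ, h'⟩⟩
            simp only [this]
          · rw [if_neg hqJ, zero_mul, if_neg (fun h' => hqJ (h' (Finset.mem_insert_self q A))), mul_zero]
        rw [Finset.sum_congr rfl fun q _ => hq q, ← Finset.sum_mul, ← Finset.sum_filter, Finset.filter_mem_eq_inter,
          Finset.univ_inter, ← Finset.mul_sum]
        ring
      rw [Finset.sum_congr rfl fun A _ => hstep A, Finset.sum_add_distrib]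
      -- regroup the double sum by `A' = insert q A`
      have hre : ∑ A : Finset (Fin K), ∑ q : Fin K, c A * tx (some q) a₀ * (if insert q A ⊆ J then (1 : ℂ) else 0)
          = ∑ A' : Finset (Fin K), (∑ p ∈ (Finset.univ : Finset (Finset (Fin K) × Fin K)) with insert p.2 p.1 = A',
              c p.1 * tx (some p.2) a₀) * (if A' ⊆ J then 1 else 0) := by
        rw [← Finset.sum_product' (f := fun A q => c A * tx (some q) a₀ * (if insert q A ⊆ J then (1 : ℂ) else 0)),
          Finset.univ_product_univ,
          ← Finset.sum_fiberwise Finset.univ (fun p : Finset (Fin K) × Fin K => insert p.2 p.1)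
            (fun p => c p.1 * tx (some p.2) a₀ * (if insert p.2 p.1 ⊆ J then (1 : ℂ) else 0))]
        refine Finset.sum_congr rfl fun A' _ => ?_
        rw [Finset.sum_mul]
        refine Finset.sum_congr rfl fun p hp => ?_
        rw [(Finset.mem_filter.mp hp).2]
      rw [hre, ← Finset.sum_add_distrib]
      refine Finset.sum_congr rfl fun A' _ => ?_
      ring

/-- **THE PENCIL OBSTRUCTION.** See the module docstring. -/
theorem det_eq_zero_of_pencil (h K r t : ℕ) (tx : Option (Fin K) → Fin h → ℂ)
    (u : Fin r → Finset (Fin h)) (hu : Function.Injective u)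
    (cols : Fin r → Finset (Fin K)) (hdown : ∀ k A, A ⊆ cols k → ∃ k', cols k' = A)
    (htop : ∀ k, (cols k).card ≤ t + 1) (Q : Finset (Fin K)) (hQ : ∀ k, (cols k).card = t + 1 → cols k ⊆ Q)
    (D B' : Finset (Fin h)) (hD : D.card = t) (hB'D : ∀ b ∈ B', b ∉ D) (hQB : Q.card < B'.card)
    (hpencil : ∀ b ∈ B', insert b D ∈ Set.range u)
    (hprofile : (Finset.univ.filter fun k => (cols k).card ≤ t).card ≤ (Finset.univ.filter fun i => (u i).card ≤ t).card) :
    (Matrix.of fun i k : Fin r => ∏ a ∈ u i, (tx none a + ∑ q ∈ cols k, tx (some q) a)).det = 0 := by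
  classical
  -- (1) the pencil coefficients `β`: more unknowns (`B'`) than equations (`Q`)
  let Tm : Matrix ↥Q ↥B' ℂ := fun q b => tx (some q.1) b.1
  have hker : LinearMap.ker Tm.mulVecLin ≠ ⊥ := by
    apply LinearMap.ker_ne_bot_of_finrank_lt
    rw [Module.finrank_fintype_fun_eq_card, Module.finrank_fintype_fun_eq_card, Fintype.card_coe, Fintype.card_coe]
    exact hQB
  obtain ⟨β, hβker, hβne⟩ := (Submodule.ne_bot_iff _).mp hker
  have hβQ : ∀ q : ↥Q, ∑ b : ↥B', tx (some q.1) b.1 * β b = 0 := by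
    intro q
    have h1 := congrFun (LinearMap.mem_ker.mp hβker) q
    rw [Matrix.mulVecLin_apply] at h1
    exact h1
  obtain ⟨b₀, hb₀⟩ : ∃ b : ↥B', β b ≠ 0 := by
    by_contra hno
    push Not at hno
    exact hβne (funext hno)
  -- the extension of `β` by zero
  let βf : Fin h → ℂ := fun b => if hb : b ∈ B' then β ⟨b, hb⟩ else 0
  have hβf : ∀ b (hb : b ∈ B'), βf b = β ⟨b, hb⟩ := fun b hb => by simp only [βf, dif_pos hb]
  have hμ : ∀ q ∈ Q, ∑ b ∈ B', βf b * tx (some q) b = 0 := by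
    intro q hq
    have h1 : ∑ b ∈ B', βf b * tx (some q) b = ∑ b : ↥B', tx (some q) b.1 * β b := by
      rw [Finset.sum_subtype B' (fun _ => Iff.rfl)]
      refine Finset.sum_congr rfl fun b _ => ?_
      have hb := hβf b.1 b.2
      rw [hb]
      ring
    rw [h1]
    exact hβQ ⟨q, hq⟩
  -- hidden points and rows as functions of the column
  let pt : Fin r → Fin h → ℂ := fun k a => tx none a + ∑ q ∈ cols k, tx (some q) a
  let row : Finset (Fin h) → (Fin r → ℂ) := fun S k => ∏ a ∈ S, pt k a
  let ind : Finset (Fin K) → (Fin r → ℂ) := fun A k => if A ⊆ cols k then 1 else 0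
  -- (2) the span of the low column indicators
  let W : Submodule ℂ (Fin r → ℂ) :=
    Submodule.span ℂ (Set.range fun k' : {k' : Fin r // (cols k').card ≤ t} => ind (cols k'.1))
  have hfinW : Module.finrank ℂ ↥W ≤ (Finset.univ.filter fun k => (cols k).card ≤ t).card := by
    refine (finrank_range_le_card _).trans ?_
    rw [Fintype.card_subtype]
  have hindW : ∀ A : Finset (Fin K), A.card ≤ t → ind A ∈ W := by
    intro A hA
    by_cases hex : ∃ k', cols k' = A
    · obtain ⟨k', hk'⟩ := hex
      refine Submodule.subset_span ⟨⟨k', by rw [hk']; exact hA⟩, ?_⟩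
      simp only [hk']
    · have : ind A = 0 := by
        funext k
        simp only [ind, Pi.zero_apply]
        rw [if_neg]
        intro hAk
        exact hex (hdown k A hAk)
      rw [this]
      exact W.zero_mem
  -- every row of size ≤ t is in W
  have hrowW : ∀ S : Finset (Fin h), S.card ≤ t → row S ∈ W := by
    intro S hS
    obtain ⟨c, hc0, hc⟩ := exists_row_expansion tx S
    have hre : row S = ∑ A : Finset (Fin K), c A • ind A := by
      funext k
      simp only [row, pt, Finset.sum_apply, Pi.smul_apply, smul_eq_mul, ind]
      rw [hc (cols k)]
    rw [hre]
    refine Submodule.sum_mem _ fun A _ => ?_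
    by_cases hA : A.card ≤ t
    · exact Submodule.smul_mem _ _ (hindW A hA)
    · rw [hc0 A (by omega), zero_smul]
      exact W.zero_mem
  -- the pencil combination `R` is in W
  let R : Fin r → ℂ := fun k => ∑ b ∈ B', βf b * row (insert b D) k
  have hRW : R ∈ W := by
    obtain ⟨c, hc0, hc⟩ := exists_row_expansion tx D
    -- `R k = λ₀ · Σ_A c A [A ⊆ cols k] + Σ_A Σ_q c A μ_q [insert q A ⊆ cols k]` with `μ_q = 0` on `Q`
    have hRk : ∀ k, R k = (∑ b ∈ B', βf b * tx none b) * ∑ A : Finset (Fin K), c A * (if A ⊆ cols k then 1 else 0)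
        + ∑ A : Finset (Fin K), ∑ q : Fin K,
            (c A * ∑ b ∈ B', βf b * tx (some q) b) * (if insert q A ⊆ cols k then 1 else 0) := by
      intro k
      have h1 : ∀ b ∈ B', βf b * row (insert b D) k = βf b * pt k b * ∏ a ∈ D, pt k a := by
        intro b hb
        simp only [row]
        rw [Finset.prod_insert (hB'D b hb), mul_assoc]
      simp only [R]
      rw [Finset.sum_congr rfl h1, ← Finset.sum_mul]
      have h2 : ∑ b ∈ B', βf b * pt k b
          = ∑ b ∈ B', βf b * tx none b + ∑ q ∈ cols k, ∑ b ∈ B', βf b * tx (some q) b := by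
        simp only [pt, mul_add, Finset.mul_sum, Finset.sum_add_distrib]
        rw [Finset.sum_comm]
      rw [h2, add_mul, hc (cols k)]
      congr 1
      rw [Finset.mul_sum]
      refine Finset.sum_congr rfl fun A _ => ?_
      have h3 : ∀ q : Fin K, (c A * ∑ b ∈ B', βf b * tx (some q) b) * (if insert q A ⊆ cols k then (1 : ℂ) else 0)
          = (if q ∈ cols k then (∑ b ∈ B', βf b * tx (some q) b) * (c A * (if A ⊆ cols k then 1 else 0)) else 0) := by
        intro q
        by_cases hqk : q ∈ cols k
        · rw [if_pos hqk]
          have : insert q A ⊆ cols k ↔ A ⊆ cols k := by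
            rw [Finset.insert_subset_iff]; exact ⟨fun h' => h'.2, fun h' => ⟨hqk, h'⟩⟩
          simp only [this]
          ring
        · rw [if_neg hqk, if_neg (fun h' => hqk (h' (Finset.mem_insert_self q A))), mul_zero]
      rw [Finset.sum_congr rfl fun q _ => h3 q, ← Finset.sum_filter, Finset.filter_mem_eq_inter, Finset.univ_inter,
        Finset.sum_mul]
    have hRe : R = (∑ b ∈ B', βf b * tx none b) • (∑ A : Finset (Fin K), c A • ind A)
        + ∑ A : Finset (Fin K), ∑ q : Fin K, (c A * ∑ b ∈ B', βf b * tx (some q) b) • ind (insert q A) := by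
      funext k
      rw [hRk k]
      simp only [Pi.add_apply, Pi.smul_apply, Finset.sum_apply, smul_eq_mul, ind]
    rw [hRe]
    refine W.add_mem (Submodule.smul_mem _ _ (Submodule.sum_mem _ fun A _ => ?_)) (Submodule.sum_mem _ fun A _ =>
      Submodule.sum_mem _ fun q _ => ?_)
    · by_cases hA : A.card ≤ t
      · exact Submodule.smul_mem _ _ (hindW A hA)
      · rw [hc0 A (by omega), zero_smul]; exact W.zero_mem
    · by_cases hA : D.card < A.card
      · rw [hc0 A hA, zero_mul, zero_smul]; exact W.zero_mem
      by_cases hqA : (insert q A).card ≤ t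
      · exact Submodule.smul_mem _ _ (hindW _ hqA)
      · -- `insert q A` has `t + 1` elements: a column containing it is a top member, so `q ∈ Q` and `μ_q = 0`
        by_cases hqQ : q ∈ Q
        · rw [hμ q hqQ, mul_zero, zero_smul]; exact W.zero_mem
        · have hzero : ind (insert q A) = 0 := by
            funext k
            simp only [ind, Pi.zero_apply]
            rw [if_neg]
            intro hsub
            have hle := Finset.card_le_card hsub
            have hcard : (cols k).card = t + 1 := by
              have := htop k
              have : (insert q A).card ≤ A.card + 1 := Finset.card_insert_le q A
              omega
            exact hqQ (hQ k hcard (hsub (Finset.mem_insert_self q A)))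
          rw [hzero, smul_zero]; exact W.zero_mem
  -- (3) too many vectors in W: a nontrivial relation
  let ι := {i : Fin r // (u i).card ≤ t} ⊕ Unit
  let fam : ι → ↥W := fun x => match x with
    | Sum.inl i => ⟨row (u i.1), hrowW _ i.2⟩
    | Sum.inr _ => ⟨R, hRW⟩
  have hdep : ¬ LinearIndependent ℂ fam := by
    intro hli
    have h1 := hli.fintype_card_le_finrank
    have h2 : Fintype.card ι = (Finset.univ.filter fun i => (u i).card ≤ t).card + 1 := by
      simp only [ι, Fintype.card_sum, Fintype.card_unit, Fintype.card_subtype]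
    rw [h2] at h1
    have := hfinW
    omega
  obtain ⟨g, hg, x₀, hx₀⟩ := Fintype.not_linearIndependent_iff.mp hdep
  have hgV : ∑ x : ι, g x • ((fam x : ↥W) : Fin r → ℂ) = 0 := by
    have := congrArg (fun w : ↥W => (w : Fin r → ℂ)) hg
    simpa only [Submodule.coe_sum, Submodule.coe_smul, Submodule.coe_zero] using this
  -- (4) the left kernel vector on the rows of the matrix
  let low : Fin r → ℂ := fun i => if hi : (u i).card ≤ t then g (Sum.inl ⟨i, hi⟩) else 0
  let pen : Fin r → ℂ := fun i => ∑ b ∈ B', if u i = insert b D then βf b else 0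
  let cvec : Fin r → ℂ := fun i => low i + g (Sum.inr ()) * pen i
  have hcardins : ∀ b ∈ B', (insert b D).card = t + 1 := fun b hb => by
    rw [Finset.card_insert_of_notMem (hB'D b hb), hD]
  have hpen_low : ∀ i, (u i).card ≤ t → pen i = 0 := by
    intro i hi
    refine Finset.sum_eq_zero fun b hb => ?_
    rw [if_neg]
    intro h'
    rw [h', hcardins b hb] at hi
    omega
  -- the unique row index of each pencil member
  have hfib : ∀ b ∈ B', ∀ f : Fin r → ℂ,
      ∑ i, (if u i = insert b D then f i else 0) = ∑ i ∈ Finset.univ.filter (fun i => u i = insert b D), f i := by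
    intro b _ f
    rw [Finset.sum_filter]
  have hfib1 : ∀ b ∈ B', ∃ i₀, u i₀ = insert b D ∧ Finset.univ.filter (fun i => u i = insert b D) = {i₀} := by
    intro b hb
    obtain ⟨i₀, hi₀⟩ := hpencil b hb
    refine ⟨i₀, hi₀, ?_⟩
    ext i
    simp only [Finset.mem_filter, Finset.mem_univ, true_and, Finset.mem_singleton]
    constructor
    · intro hi; exact hu (hi.trans hi₀.symm)
    · rintro rfl; exact hi₀
  have hvec : Matrix.vecMul cvec (Matrix.of fun i k : Fin r => ∏ a ∈ u i, (tx none a + ∑ q ∈ cols k, tx (some q) a)) = 0 := by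
    funext k
    have hk := congrFun hgV k
    rw [Finset.sum_apply, Pi.zero_apply, Fintype.sum_sum_type] at hk
    simp only [Pi.smul_apply, smul_eq_mul, Finset.univ_unique, Finset.sum_singleton, PUnit.default_eq_unit] at hk
    rw [Matrix.vecMul, dotProduct, Pi.zero_apply]
    simp only [Matrix.of_apply]
    have hsplit : ∑ i, cvec i * ∏ a ∈ u i, (tx none a + ∑ q ∈ cols k, tx (some q) a)
        = ∑ i, low i * row (u i) k + g (Sum.inr ()) * ∑ i, pen i * row (u i) k := by
      simp only [cvec, row, pt, add_mul, Finset.sum_add_distrib, Finset.mul_sum, mul_assoc]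
    rw [hsplit]
    -- the low part
    have hlow : ∑ i, low i * row (u i) k = ∑ i : {i : Fin r // (u i).card ≤ t}, g (Sum.inl i) * row (u i.1) k := by
      rw [← Finset.sum_subset (Finset.subset_univ (Finset.univ.filter fun i => (u i).card ≤ t)),
        Finset.sum_subtype (Finset.univ.filter fun i => (u i).card ≤ t) (p := fun i => (u i).card ≤ t)
          (fun i => by simp)]
      · refine Finset.sum_congr rfl fun i _ => ?_
        simp only [low, dif_pos i.2]
      · intro i _ hi
        have hi' : ¬ (u i).card ≤ t := fun h' => hi (Finset.mem_filter.mpr ⟨Finset.mem_univ _, h'⟩)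
        simp only [low, dif_neg hi', zero_mul]
    -- the pencil part
    have hpenR : ∑ i, pen i * row (u i) k = R k := by
      simp only [pen, R, Finset.sum_mul]
      rw [Finset.sum_comm]
      refine Finset.sum_congr rfl fun b hb => ?_
      obtain ⟨i₀, hi₀, hfil⟩ := hfib1 b hb
      have : ∀ i, (if u i = insert b D then βf b else 0) * row (u i) k = if u i = insert b D then βf b * row (insert b D) k else 0 := by
        intro i
        by_cases h' : u i = insert b D
        · rw [if_pos h', if_pos h', h']
        · rw [if_neg h', if_neg h', zero_mul]
      rw [Finset.sum_congr rfl fun i _ => this i, hfib b hb, hfil, Finset.sum_singleton]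
    rw [hlow, hpenR]
    have hfam : ∀ i : {i : Fin r // (u i).card ≤ t}, ((fam (Sum.inl i) : ↥W) : Fin r → ℂ) k = row (u i.1) k := fun i => rfl
    have hfamR : ((fam (Sum.inr ()) : ↥W) : Fin r → ℂ) k = R k := rfl
    simp only [hfam, hfamR] at hk
    exact hk
  have hcne : cvec ≠ 0 := by
    intro hc0
    rcases x₀ with i | _
    · have := congrFun hc0 i.1
      simp only [cvec, Pi.zero_apply, hpen_low i.1 i.2, mul_zero, add_zero, low, dif_pos i.2] at this
      exact hx₀ this
    · obtain ⟨i₀, hi₀, hfil⟩ := hfib1 b₀.1 b₀.2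
      have := congrFun hc0 i₀
      have hlow0 : low i₀ = 0 := by
        have : ¬ (u i₀).card ≤ t := by rw [hi₀, hcardins b₀.1 b₀.2]; omega
        simp only [low, dif_neg this]
      have hpen0 : pen i₀ = βf b₀.1 := by
        simp only [pen]
        rw [Finset.sum_eq_single_of_mem b₀.1 b₀.2]
        · rw [if_pos hi₀]
        · intro b hb hne
          rw [if_neg]
          intro h'
          apply hne
          have hmem : b ∈ insert b D := Finset.mem_insert_self b D
          rw [← h', hi₀, Finset.mem_insert] at hmem
          rcases hmem with h'' | h''
          · exact h''
          · exact absurd h'' (hB'D b hb)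
      simp only [cvec, Pi.zero_apply, hlow0, zero_add, hpen0, hβf b₀.1 b₀.2] at this
      rcases mul_eq_zero.mp this with h' | h'
      · exact hx₀ h'
      · exact hb₀ h'
  exact Matrix.exists_vecMul_eq_zero_iff.mp ⟨cvec, hcne, hvec⟩

end BallDiag

end

end Summit.ValiantsHypothesis.ValiantsHypothesis.Theorems.BarrierLever.HiddenStates
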